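import Summits.HodgeConjecture.HodgeConjecture.Theorems.HeckePrymWeilHodgeWeilOfWeilTransport
import HarnessLib

/-!
# Crux `WeilTwelvefoldsSqrtMinus7` holds UNCONDITIONALLY on the isogeny class of the tensor locus

Route `HeckePrymWeil` (sub-problem `HodgeConjecture`); lead seat c6 of crux `WeilTwelvefoldsSqrtMinus7`
(stmt-HodgeConjecture-1261), line `isotypic-unimodular-saturation`, reshape r5.

The line's ANCHOR delivers the crux without any transport and without any family fact on the locus it
meets: if the `√-7`-abelian twelvefold `(A, φ)` admits an ISOGENY PAIR towards a TENSOR POINT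
`(A₁ × A₁, (x, y) ↦ (-7·y, x))` — `A₁` any complex abelian sixfold, `f : A → A₁ × A₁`, `g : A₁ × A₁ → A`,
`f ≫ g = [m]`, `m ≥ 1`, `f` flat, `g` intertwining the companion `√-7` with `φ` (this is `A₁ ⊗_ℤ ℤ[√-7]` up to
`K`-isogeny; a 21-parameter locus in the 36-dimensional moduli of `√-7`-Weil twelvefolds, meeting EVERY
discriminant component at its CM points) — then EVERY class of the typed Weil plane of `(A, φ)` is algebraic
(no rationality or Hodge-type hypothesis needed): Deligne's Lemma 4.5 / Remark 4.10 on the tree's real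
carriers, assembled from the landed `stub_upgrade` (typed plane ≤ strong Weil plane, via `b₁ = 2 dim` and the
exterior structure of `H^•(A(ℂ))`), `stub_pointClassAnchor` (the strong Weil plane of the tensor point is
spanned by pull-backs of the point class of `A₁`) and `stub_isogenyTransfer` (`owf_anchorAlgebraic`).

* `weilTwelvefoldsSqrtMinus7_on_tensorLocus` — the registered sub-goal (unconditional theorem);
* `weilTwelvefoldsSqrtMinus7_restricted_to_tensorLocus` — the crux's own conclusion, verbatim, under the
  extra isogeny-pair hypothesis.

This is exactly the anchor fibre `s₀` of Deligne's family (clause (b) of the named fact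
`deligne1982_weilFamily_globalAction`); what remains of the crux off this locus is the Weil transport
`WT(7, 6)` (`HeckePrymWeilWeilTwelvefoldsSqrtMinus7OfGlobalAction`). No `sorry`, no new definition.
-/

noncomputable section

-- every declaration of this problem lives in `Summit.HodgeConjecture.HodgeConjecture.…` (summit = sub-problem)
set_option linter.dupNamespace false

open CategoryTheory AlgebraicGeometry Limits MonoidalCategory CartesianMonoidalCategory

namespace Summit.HodgeConjecture.HodgeConjecture.Theorems.HeckePrymWeilLine

open Literature.AlgebraicGeometry Literature.AlgebraicGeometry.Motives Literature.AlgebraicGeometry.HodgeTheory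
open Literature.AlgebraicTopology.SingularHomology
open Summit.HodgeConjecture.HodgeConjecture.Theses.HeckePrymWeil

/-- **The typed Weil plane of a `√-7`-abelian twelvefold `K`-isogenous to a tensor point consists of
algebraic classes** (UNCONDITIONAL).  For `(A, φ)`, `A.dim = 12`, `φ ≫ φ = -7`, an abelian sixfold `A₁` and
an isogeny pair `f : A → A₁ × A₁`, `g : A₁ × A₁ → A` (`f ≫ g = [m]`, `m ≥ 1`, `f` flat) with `g`
intertwining the companion endomorphism `(x, y) ↦ (-7·y, x)` and `φ`, every class of
`Eig((𝟙+φ)^*, (1+i√7)¹²) ⊔ Eig((𝟙+φ)^*, (1-i√7)¹²)` is algebraic: typing upgrade to the strong Weil plane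
(`stub_upgrade`), then Deligne's tensor-point anchor across the isogeny (`owf_anchorAlgebraic`).
[cite: Deligne1982HodgeCycles, Lemma 4.5 and Remark 4.10] [cite: vanGeemen1994HodgeAV, 5.4–5.7] -/
theorem weilTwelvefoldsSqrtMinus7_on_tensorLocus :
    ∀ (A : AbelianVariety ℂ) (φ : A ⟶ A), A.dim = 12 → φ ≫ φ = -((7 : ℤ) • 𝟙 A) →
    ∀ (A₁ : AbelianVariety ℂ) (f : A ⟶ A₁.prod A₁) (g : A₁.prod A₁ ⟶ A) (m : ℕ),
      A₁.dim = 6 → 0 < m → f ≫ g = m • 𝟙 A → Flat f.hom.hom.hom.left →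
      g ≫ φ = AbelianVariety.prodLift (AbelianVariety.snd A₁ A₁ ≫ (-((7 : ℤ) • 𝟙 A₁)))
        (AbelianVariety.fst A₁ A₁) ≫ g →
    ∀ c : complexBetti A.X 12,
      c ∈ Module.End.eigenspace (complexBetti.map (𝟙 A + φ).hom.hom.hom 12).hom
            ((1 + Complex.I * (Real.sqrt (7 : ℝ) : ℂ)) ^ 12) ⊔
          Module.End.eigenspace (complexBetti.map (𝟙 A + φ).hom.hom.hom 12).hom
            ((1 - Complex.I * (Real.sqrt (7 : ℝ) : ℂ)) ^ 12) →
      c ∈ algebraicClasses A.X 6 := by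
  intro A φ hA hφ A₁ f g m hA₁ hm hfg hf hg c hc
  have h7 : Nat.Prime 7 := by norm_num
  have hA' : A.dim = 2 * 6 := by rw [hA]
  have hφ' : φ ≫ φ = -(((7 : ℕ) : ℤ) • 𝟙 A) := by exact_mod_cast hφ
  have hg' : g ≫ φ = AbelianVariety.prodLift (AbelianVariety.snd A₁ A₁ ≫ (-(((7 : ℕ) : ℤ) • 𝟙 A₁)))
      (AbelianVariety.fst A₁ A₁) ≫ g := by exact_mod_cast hg
  -- typing upgrade: the typed plane lies in the strong Weil plane of `(A, φ)`
  have hcW : c ∈ weilClassesOf A φ 6 7 :=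
    stub_upgrade 7 h7 (by norm_num) le_rfl 6 A φ hA' hφ' (by exact_mod_cast hc)
  -- Deligne's tensor-point anchor across the isogeny pair
  exact owf_anchorAlgebraic h7 (by norm_num) le_rfl A₁ f g m hA₁ hA' hφ' hm hfg hf hg' hcW

/-- **The crux `WeilTwelvefoldsSqrtMinus7` RESTRICTED to the isogeny class of the tensor locus holds** — its
conclusion verbatim (rational `(6,6)` classes of the typed Weil plane are algebraic) for every `(A, φ)`
admitting an isogeny pair towards a tensor point `(A₁ × A₁, companion)`; the rationality and Hodge-type
hypotheses are not even used. [cite: Deligne1982HodgeCycles, Lemma 4.5 and Remark 4.10] -/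
theorem weilTwelvefoldsSqrtMinus7_restricted_to_tensorLocus
    (A : AbelianVariety ℂ) (φ : A ⟶ A) (hA : A.dim = 12) (hφ : φ ≫ φ = -((7 : ℤ) • 𝟙 A))
    (hT : ∃ (A₁ : AbelianVariety ℂ) (f : A ⟶ A₁.prod A₁) (g : A₁.prod A₁ ⟶ A) (m : ℕ),
      A₁.dim = 6 ∧ 0 < m ∧ f ≫ g = m • 𝟙 A ∧ Flat f.hom.hom.hom.left ∧
      g ≫ φ = AbelianVariety.prodLift (AbelianVariety.snd A₁ A₁ ≫ (-((7 : ℤ) • 𝟙 A₁)))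
        (AbelianVariety.fst A₁ A₁) ≫ g)
    (c : complexBetti A.X 12) (_hrat : IsRationalClass c) (_hH : IsOfHodgeType 12 A.X 12 6 6 c)
    (hc : c ∈ Module.End.eigenspace (complexBetti.map (𝟙 A + φ).hom.hom.hom 12).hom
            ((1 + Complex.I * (Real.sqrt (7 : ℝ) : ℂ)) ^ 12) ⊔
          Module.End.eigenspace (complexBetti.map (𝟙 A + φ).hom.hom.hom 12).hom
            ((1 - Complex.I * (Real.sqrt (7 : ℝ) : ℂ)) ^ 12)) :
    c ∈ algebraicClasses A.X 6 := by
  obtain ⟨A₁, f, g, m, hA₁, hm, hfg, hf, hg⟩ := hT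
  exact weilTwelvefoldsSqrtMinus7_on_tensorLocus A φ hA hφ A₁ f g m hA₁ hm hfg hf hg c hc

end Summit.HodgeConjecture.HodgeConjecture.Theorems.HeckePrymWeilLine

end
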